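import Summits.HodgeConjecture.HodgeConjecture.Theorems.Ring2AbelianAllWeilCellsInhabited
import Summits.HodgeConjecture.HodgeConjecture.Theorems.Ring2AbelianAllWeilFloorRebase
import Literature.AlgebraicGeometry.HodgeTheory.MaximalPicardNumberHodgeClasses
import Literature.AlgebraicGeometry.HodgeTheory.HodgeClassesProductSpanCMSquare
import HarnessLib

/-!
# Ring 2 · AbelianAll (ab-weil-1, gen 8, part 4) — every right-sign component has a CM ANCHOR on which the
  Hodge conjecture HOLDS (Tate), and the exact residual of a cell is ISOGENY-CONNECTEDNESS + the variational instance

research route, not a corollary; conditional on HC_CM plus one named minimal statement.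
Cell line: research route conditional on HC_CM; not a corollary; Q11.4-sentence-2 already refuted in dim ≥ 3.
`HC_CM` (`Theses.RankFourFaces.CMAbelianHodge`) does not occur in this file. What is proved about the Hodge
conjecture here is Tate's theorem for products of ONE CM elliptic curve (van Geemen Thm. 4.3, in the tree:
`EllipticCurve.hodgeConjectureFor_of_hodgeOneZero_mem_span_pullback`) applied to the members of the CM tower of
part 2 — nothing about a general member of a cell.

THE ANCHOR (`weilComponent_cmAnchor`). The CM tower of part 2 is re-run with ONE curve `E₀ = ℂ/ℤ[√-d]` fixed and
two invariants carried along: the `(1,0)`-classes of the member are pull-backs from `E₀`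
(`hodgeOneZero_mem_span_pullback_self/prod`), and the member is of CM type (`isOfCMType_of_cmCurve`,
`IsOfCMType.prod`). Consequently EVERY right-sign component `(n, d, δ)` (`sign δ = (-1)ⁿ`, part 2) contains a
polarized member `(A, φ, h_K)` of EXACT discriminant class `δ` which is of CM type, satisfies the Hodge conjecture
OUTRIGHT, and all of whose Hodge classes are divisorial — so on that member the conclusion of
`WeilClassesComponent n d δ` is TRUE (`weilClassesComponent_holds_at_cmAnchor`), and gen 5's anchor predicate
`divisorGeneratedCMAnchor` ("met in print on every component by the diagonal member `E_Kⁿ × E_Kⁿ`", census VII-C) is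
met IN THE KERNEL, in every right-sign cell, by a member of that very cell (`divisorGeneratedCMAnchor_of_cmAnchor`).

THE EXACT RESIDUAL (`IsogenyConnectedWeilComponent`, typed missing input, NOT a case of HC). Gen 5's anchor engine
`WeilClassesComponent ⟸ PointedWeilFamilies(anchor) ∧ WeilVariationalHodgeComponent` bundled, in its family leaf,
the moduli statement with the anchor. With the anchor now a theorem the family leaf SPLITS: what remains is the pure
moduli statement that any two members of the component are deformation equivalent UP TO ISOGENY through a
`(ℚ(√-d), 2n, δ)`-Weil family carrying the class — in print: "the triple `(n, K, det H)` … is a discrete invariant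
of a component of the moduli space, which determines it up to isogenies of abelian varieties of Weil type"
(Markman, arXiv:2502.03415 p. 3, citing van Geemen; Floccari–Fu, JMPA 2026, p. 3: "each family is characterized
by the field `ℚ(√-d)` and … the discriminant"). Rows: `anchoredWeilFamiliesComponent_of_isogenyConnected`
(R∞anc(δ) from isogeny-connectedness, right sign), `weilClassesComponent_of_isogenyConnected_of_variational`
(EVERY cell: wrong sign is gen 7, right sign is anchor + connectedness + VHC instance), the column
`weilClassesByComponent_of_isogenyConnected_of_variational`, and the dim `≤ 5` floor
`hodgeConjectureFor_abelian_dim_le_five_of_refereed_connected_variational`, whose per-cell residual is now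
`IsogenyConnectedWeilComponent 2 d₀ δ ∧ WeilVariationalHodgeComponent 2 d₀ δ` on the positive non-split squarefree
cells — a moduli statement closed in print plus ONE instance of Grothendieck's variational Hodge conjecture
(the shape of Markman's and Floccari–Fu's theorems), the CM-anchor input being discharged here for all cells.

## References
* B. van Geemen, *An introduction to the Hodge conjecture for abelian varieties*, LNM 1594 (1994), Thm. 4.3,
  4.11, 4.14, Lemma 5.2, 5.3–5.5. [vanGeemen1994HodgeAV]
* E. Markman, *Cycles on abelian 2n-folds of Weil type from secant sheaves on abelian n-folds*, arXiv:2502.03415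
  (2025), p. 3 and Thm. 1.5.1 (preprint, unrefereed). [Markman2025SecantWeil]
* F. Charles, C. Schnell, *Notes on absolute Hodge classes* (2014), Conj. 11.3.1. [CharlesSchnell2014Notes]
* B. Gordon, *A survey of the Hodge conjecture for abelian varieties* (1997), §3. [Gordon1997]
-/

noncomputable section

set_option linter.dupNamespace false

open CategoryTheory MonoidalCategory AlgebraicGeometry
open Literature.AlgebraicGeometry Literature.AlgebraicGeometry.Motives
open Literature.AlgebraicGeometry.Motives.SegreHyperplaneClass
open Literature.AlgebraicGeometry.HodgeTheory
open Literature.AlgebraicGeometry.Milne1999 (IsOfCMType)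
open Literature.AlgebraicGeometry.VanGeemen1994
open Literature.AlgebraicTopology.SingularHomology
open Literature.Barriers.HodgeConjecture (divisorClassesSpan)
open Literature.Geometry.Kaehler
open Summit.HodgeConjecture.HodgeConjecture.Ring2.Hypotheses

namespace Summit.HodgeConjecture.HodgeConjecture.Ring2.AbelianAll

/-! ### §1 The CM tower over ONE curve, with the generation and CM-type invariants -/

/-- **The CM square over a FIXED curve inhabits `(1, d, [-m₁m₂])`, with invariants**: for `E₀` with `ψ₀² = -d`
and weights `m₁, m₂ ≥ 1`, the pair `(E₀ × E₀, ψ₀ × (-ψ₀))` with its weighted Segre embedding is of Weil type `(1,d)`,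
has `det H = [-m₁m₂]`, `h_K² ≠ 0`, its `(1,0)`-classes are pull-backs from `E₀`, and it is of CM type.
[cite: vanGeemen1994HodgeAV, 5.3 and Lemma 5.2 (2)–(4)] [cite: Milne1999, §2 p. 54] -/
theorem exists_cmMember_one (g : (N : ℕ) → complexBetti (projectiveSpace N ℂ) 2)
    (hgr : ∀ N : ℕ, IsRationalClass (g N)) (hgnz : ∀ N : ℕ, 1 ≤ N → g N ≠ 0)
    (hgσ : ∀ n m : ℕ, complexBetti.map (segreEmbedding n m ℂ) 2 (g (n * m + n + m)) =
      complexBetti.map (CartesianMonoidalCategory.fst (projectiveSpace n ℂ) (projectiveSpace m ℂ)) 2 (g n) +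
        complexBetti.map (CartesianMonoidalCategory.snd (projectiveSpace n ℂ) (projectiveSpace m ℂ)) 2 (g m))
    {E₀ : AbelianVariety ℂ} {ψ₀ : E₀ ⟶ E₀} {d : ℕ} (hE : E₀.dim = 1) (hd : 0 < d) (hψ : ψ₀ ≫ ψ₀ = -(d • 𝟙 E₀))
    {m₁ m₂ : ℕ} (hm₁ : 0 < m₁) (hm₂ : 0 < m₂) (h0 : ((m₁ : ℚ) * m₂) ≠ 0) :
    ∃ (A : AbelianVariety ℂ) (φ : A ⟶ A) (e : ProjectiveEmbedding A.X), IsWeilType A φ 1 d ∧ 1 ≤ e.n ∧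
      HasWeilDiscriminantNondeg A φ 1 d
          ((d : ℂ) • complexBetti.map e.ι 2 (g e.n) + complexBetti.map φ.hom.hom.hom 2 (complexBetti.map e.ι 2 (g e.n)))
          (QuotientGroup.mk (-(Units.mk0 ((m₁ : ℚ) * m₂) h0))) ∧
      lefschetzPow ((d : ℂ) • complexBetti.map e.ι 2 (g e.n) + complexBetti.map φ.hom.hom.hom 2 (complexBetti.map e.ι 2 (g e.n)))
          (2 * 1 - 1) 2
        ((d : ℂ) • complexBetti.map e.ι 2 (g e.n) + complexBetti.map φ.hom.hom.hom 2 (complexBetti.map e.ι 2 (g e.n))) ≠ 0 ∧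
      (∀ u : complexBetti A.X 1, IsOfHodgeType A.dim A.X 1 1 0 u →
        u ∈ Submodule.span ℂ {y : complexBetti A.X 1 | ∃ (g : A ⟶ E₀) (w : complexBetti E₀.X 1),
          IsOfHodgeType E₀.dim E₀.X 1 1 0 w ∧ y = complexBetti.map g.hom.hom.hom 1 w}) ∧
      IsOfCMType A := by
  obtain ⟨M, f₀, e, hM, hen, hecl⟩ := exists_projectiveEmbedding_cmSquare g hgσ E₀ hm₁ hm₂
  obtain ⟨hBdim, -, hΨ, up, um, hup, hum, -, hH, hup0, -⟩ := exists_weilType_cmSquare hE hd hψ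
  have hdis := disjoint_weilClassesPlus_weilClassesMinus (A := E₀.prod E₀)
    (φ := AbelianVariety.prodLift (AbelianVariety.fst E₀ E₀ ≫ ψ₀) (AbelianVariety.snd E₀ E₀ ≫ (-ψ₀))) one_pos hd
  have hc0 : up + um ≠ 0 := by
    intro h
    have hup' : up ∈ weilClassesMinus (E₀.prod E₀)
        (AbelianVariety.prodLift (AbelianVariety.fst E₀ E₀ ≫ ψ₀) (AbelianVariety.snd E₀ E₀ ≫ (-ψ₀))) 1 d := by
      rw [eq_neg_of_add_eq_zero_left h]; exact Submodule.neg_mem _ hum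
    exact hup0 (Submodule.disjoint_def.1 hdis up hup hup')
  have hW : IsWeilType (E₀.prod E₀)
      (AbelianVariety.prodLift (AbelianVariety.fst E₀ E₀ ≫ ψ₀) (AbelianVariety.snd E₀ E₀ ≫ (-ψ₀))) 1 d :=
    isWeilType_of_weilClass_ne_zero one_pos hd hBdim hΨ
      (Submodule.add_mem _ (weilClassesPlus_le_weilClassesOf _ _ 1 d hup) (weilClassesMinus_le_weilClassesOf _ _ 1 d hum))
      hc0 hH
  have hηr : IsRationalClass (complexBetti.map f₀ 2 (g M)) := (hgr M).pullback (AlgPoints.mapContinuous (L := ℂ) f₀)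
  have hη0 : complexBetti.map f₀ 2 (g M) ≠ 0 := by
    intro h0'
    obtain ⟨δ, hδ⟩ := exists_hasWeilDiscriminantNondeg one_pos hBdim hd hΨ e (hgr _) (hgnz _ hen)
    have hcl : complexBetti.map e.ι 2 (g e.n) = 0 := by
      rw [hecl, h0', smul_zero, smul_zero, map_zero, map_zero, add_zero]
    rw [hcl, map_zero, smul_zero, add_zero] at hδ
    exact not_hasWeilDiscriminantNondeg_zero one_pos δ hδ
  have h2 : ∀ x : complexBetti E₀.X 2, complexBetti.map ψ₀.hom.hom.hom 2 x = (d : ℂ) • x :=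
    fun x => cmCurve_map_two hE hd hψ x
  have hψ' : (-ψ₀) ≫ (-ψ₀) = -(d • 𝟙 E₀) := by rw [Preadditive.neg_comp_neg]; exact hψ
  have h2' : ∀ x : complexBetti E₀.X 2, complexBetti.map (-ψ₀).hom.hom.hom 2 x = (d : ℂ) • x :=
    fun x => cmCurve_map_two hE hd hψ' x
  have hs₁ : ((2 * d * m₁ : ℕ) : ℚ) ≠ 0 := by positivity
  have hs₂ : ((2 * d * m₂ : ℕ) : ℚ) ≠ 0 := by positivity
  have hK : (d : ℂ) • complexBetti.map e.ι 2 (g e.n) +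
      complexBetti.map (AbelianVariety.prodLift (AbelianVariety.fst E₀ E₀ ≫ ψ₀)
        (AbelianVariety.snd E₀ E₀ ≫ (-ψ₀))).hom.hom.hom 2 (complexBetti.map e.ι 2 (g e.n)) =
      complexBetti.map (AbelianVariety.fst E₀ E₀).hom.hom.hom 2
          ((((2 * d * m₁ : ℕ) : ℚ) : ℂ) • complexBetti.map f₀ 2 (g M)) +
        complexBetti.map (AbelianVariety.snd E₀ E₀).hom.hom.hom 2
          ((((2 * d * m₂ : ℕ) : ℚ) : ℂ) • complexBetti.map f₀ 2 (g M)) := by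
    have e₁ : (d : ℂ) * ((m₁ : ℕ) : ℂ) + (d : ℂ) * ((m₁ : ℕ) : ℂ) = (((2 * d * m₁ : ℕ) : ℚ) : ℂ) := by
      push_cast; ring
    have e₂ : (d : ℂ) * ((m₂ : ℕ) : ℂ) + (d : ℂ) * ((m₂ : ℕ) : ℂ) = (((2 * d * m₂ : ℕ) : ℚ) : ℂ) := by
      push_cast; ring
    rw [hecl, smul_add_map_prodLift, h2, h2', smul_smul, ← add_smul, e₁, smul_smul, ← add_smul, e₂]
  obtain ⟨hN, htop⟩ := hasWeilDiscriminantNondeg_cmSquare hE hd hψ hηr hη0 hs₁ hs₂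
  have hδ : (QuotientGroup.mk (-(Units.mk0 _ hs₁ * Units.mk0 _ hs₂)) : weilNormResidueGroup d) =
      QuotientGroup.mk (-(Units.mk0 ((m₁ : ℚ) * m₂) h0)) := by
    rw [← mk_pow_two_mul_pow_mul d (Units.mk0 ((2 * d : ℕ) : ℚ) (by positivity))
      (-(Units.mk0 ((m₁ : ℚ) * m₂) h0)) 1]
    congr 1
    ext
    simp only [Units.val_neg, Units.val_mul, Units.val_pow_eq_pow_val, Units.val_mk0]
    push_cast
    ring
  refine ⟨E₀.prod E₀, _, e, hW, hen, ?_, ?_, ?_, ?_⟩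
  · rw [hK, ← hδ]; exact hN
  · rw [hK]; exact htop
  · exact AbelianVariety.hodgeOneZero_mem_span_pullback_prod E₀ E₀ E₀
      (AbelianVariety.hodgeOneZero_mem_span_pullback_self E₀) (AbelianVariety.hodgeOneZero_mem_span_pullback_self E₀)
  · exact (isOfCMType_of_cmCurve hE hd hψ).prod (isOfCMType_of_cmCurve hE hd hψ)

/-- **The CM tower over ONE curve** (induction on `n`, as in part 2's `exists_member`), carrying the generation
invariant "`H^{1,0}` is pulled back from `E₀`" and CM type through products.
[cite: vanGeemen1994HodgeAV, 4.11, 4.14, 5.3 and Lemma 5.2 (3)] [cite: Milne1999, §2 p. 54] -/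
theorem exists_cmMember (g : (N : ℕ) → complexBetti (projectiveSpace N ℂ) 2)
    (hgr : ∀ N : ℕ, IsRationalClass (g N)) (hgnz : ∀ N : ℕ, 1 ≤ N → g N ≠ 0)
    (hgσ : ∀ n m : ℕ, complexBetti.map (segreEmbedding n m ℂ) 2 (g (n * m + n + m)) =
      complexBetti.map (CartesianMonoidalCategory.fst (projectiveSpace n ℂ) (projectiveSpace m ℂ)) 2 (g n) +
        complexBetti.map (CartesianMonoidalCategory.snd (projectiveSpace n ℂ) (projectiveSpace m ℂ)) 2 (g m))
    {E₀ : AbelianVariety ℂ} {ψ₀ : E₀ ⟶ E₀} {d : ℕ} (hE : E₀.dim = 1) (hd : 0 < d) (hψ : ψ₀ ≫ ψ₀ = -(d • 𝟙 E₀))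
    {n : ℕ} (hn : 1 ≤ n) {δ : weilNormResidueGroup d} (hδ : weilSign d δ = (-1) ^ n) :
    ∃ (A : AbelianVariety ℂ) (φ : A ⟶ A) (e : ProjectiveEmbedding A.X), IsWeilType A φ n d ∧ 1 ≤ e.n ∧
      HasWeilDiscriminantNondeg A φ n d
          ((d : ℂ) • complexBetti.map e.ι 2 (g e.n) + complexBetti.map φ.hom.hom.hom 2 (complexBetti.map e.ι 2 (g e.n)))
          δ ∧
      lefschetzPow ((d : ℂ) • complexBetti.map e.ι 2 (g e.n) + complexBetti.map φ.hom.hom.hom 2 (complexBetti.map e.ι 2 (g e.n)))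
          (2 * n - 1) 2
        ((d : ℂ) • complexBetti.map e.ι 2 (g e.n) + complexBetti.map φ.hom.hom.hom 2 (complexBetti.map e.ι 2 (g e.n))) ≠ 0 ∧
      (∀ u : complexBetti A.X 1, IsOfHodgeType A.dim A.X 1 1 0 u →
        u ∈ Submodule.span ℂ {y : complexBetti A.X 1 | ∃ (g : A ⟶ E₀) (w : complexBetti E₀.X 1),
          IsOfHodgeType E₀.dim E₀.X 1 1 0 w ∧ y = complexBetti.map g.hom.hom.hom 1 w}) ∧
      IsOfCMType A := by
  induction n, hn using Nat.le_induction generalizing δ with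
  | base =>
    obtain ⟨q, rfl⟩ := QuotientGroup.mk_surjective δ
    rw [show ((-1 : ℤˣ) ^ (1 : ℕ)) = -1 from pow_one _, weilSign_mk, ratSign_eq_neg_one_iff] at hδ
    obtain ⟨a, b, ha, hb, hab⟩ := exists_mk_neg_natCast_mul_eq d q hδ
    have h0 : ((a : ℚ) * b) ≠ 0 := by positivity
    rw [← hab h0]
    exact exists_cmMember_one g hgr hgnz hgσ hE hd hψ ha hb h0
  | succ n hn IH =>
    have h11 : (((1 : ℕ) : ℚ) * (1 : ℕ)) ≠ 0 := by norm_num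
    have hneg : ((-(Units.mk0 _ h11) : ℚˣ) : ℚ) < 0 := by simp
    have hδ' : weilSign d (δ * QuotientGroup.mk (-(Units.mk0 _ h11))) = (-1) ^ n := by
      rw [map_mul, hδ, weilSign_mk_of_neg d hneg, show ((-1 : ℤˣ) ^ (n + 1 : ℕ)) = (-1) ^ (n : ℕ) * (-1) from pow_succ _ _,
        mul_assoc, show ((-1 : ℤˣ) * -1) = 1 from by simp, mul_one]
    obtain ⟨A, φ, eA, hWA, heA, hNA, htA, hgA, hcA⟩ := IH hδ'
    obtain ⟨B, ψ, eB, hWB, heB, hNB, htB, hgB, hcB⟩ := exists_cmMember_one g hgr hgnz hgσ hE hd hψ one_pos one_pos h11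
    obtain ⟨e, hen, hecl⟩ := exists_projectiveEmbedding_prod g hgσ eA eB
    obtain ⟨hP, htP⟩ := hasWeilDiscriminantNondeg_prod hWA.pos hWB.pos hWA.dim_eq hWB.dim_eq
      (isRationalClass_ksymm d φ eA (hgr _)) (isRationalClass_ksymm d ψ eB (hgr _)) htA htB hNA hNB
    have hK : (d : ℂ) • complexBetti.map e.ι 2 (g e.n) +
        complexBetti.map (AbelianVariety.prodLift (AbelianVariety.fst A B ≫ φ)
          (AbelianVariety.snd A B ≫ ψ)).hom.hom.hom 2 (complexBetti.map e.ι 2 (g e.n)) =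
        complexBetti.map (AbelianVariety.fst A B).hom.hom.hom 2
            ((d : ℂ) • complexBetti.map eA.ι 2 (g eA.n) + complexBetti.map φ.hom.hom.hom 2 (complexBetti.map eA.ι 2 (g eA.n))) +
          complexBetti.map (AbelianVariety.snd A B).hom.hom.hom 2
            ((d : ℂ) • complexBetti.map eB.ι 2 (g eB.n) + complexBetti.map ψ.hom.hom.hom 2 (complexBetti.map eB.ι 2 (g eB.n))) := by
      rw [hecl]; exact smul_add_map_prodLift φ ψ (d : ℂ) _ _
    have hxx : (-(Units.mk0 _ h11) : ℚˣ) * -(Units.mk0 _ h11) = 1 := by ext; simp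
    have hmul : δ * QuotientGroup.mk (-(Units.mk0 _ h11)) * QuotientGroup.mk (-(Units.mk0 _ h11)) = δ := by
      rw [mul_assoc, ← QuotientGroup.mk_mul, hxx, QuotientGroup.mk_one, mul_one]
    refine ⟨A.prod B, _, e, isWeilType_prod hWA hWB, le_trans heB hen, ?_, ?_,
      AbelianVariety.hodgeOneZero_mem_span_pullback_prod E₀ A B hgA hgB, hcA.prod hcB⟩
    · rw [hK, ← hmul]; exact hP
    · rw [hK]; exact htP

/-- **THE CM ANCHOR OF A RIGHT-SIGN COMPONENT.** For `n ≥ 1`, `d ≥ 1`, `sign δ = (-1)ⁿ`: a polarized member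
`(A, φ, d·e^*a + φ^*e^*a)` of the component `(n, d, δ)` (exact discriminant class `δ`, Weil type `(n, n)`) which is
of CM type, SATISFIES THE HODGE CONJECTURE (Tate / van Geemen Thm. 4.3, `E₀`-products), and all of whose Hodge
classes are divisorial. UNCONDITIONAL. [cite: vanGeemen1994HodgeAV, Thm. 4.3, 4.11, 4.14 and 5.3] [cite: Gordon1997, §3] -/
theorem weilComponent_cmAnchor {n d : ℕ} (hn : 0 < n) (hd : 0 < d) {δ : weilNormResidueGroup d}
    (hδ : weilSign d δ = (-1) ^ n) :
    ∃ (A : AbelianVariety ℂ) (φ : A ⟶ A) (e : ProjectiveEmbedding A.X) (a : complexBetti (projectiveSpace e.n ℂ) 2),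
      A.dim = 2 * n ∧ IsSmoothProjective (2 * n) A.X ∧ φ ≫ φ = -(d • 𝟙 A) ∧ IsRationalClass a ∧ a ≠ 0 ∧
        HasWeilDiscriminantNondeg A φ n d
          ((d : ℂ) • complexBetti.map e.ι 2 a + complexBetti.map φ.hom.hom.hom 2 (complexBetti.map e.ι 2 a)) δ ∧
        IsWeilType A φ n d ∧ IsOfCMType A ∧ HodgeConjectureFor A.dim A.X ∧
        ∀ (p : ℕ) (y : complexBetti A.X (2 * p)), IsRationalClass y → IsOfHodgeType A.dim A.X (2 * p) p p y →
          y ∈ divisorClassesSpan A.X A.dim p := by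
  obtain ⟨g, hgr, hgnz, hgσ⟩ := exists_segreHyperplaneClasses
  obtain ⟨E₀, ψ₀, hE, hψ⟩ := Literature.NumberTheory.EllipticCurves.CMEndomorphism.exists_cmCurve_sqrt_neg d hd
  obtain ⟨A, φ, e, hW, hen, hN, -, hgen, hcm⟩ := exists_cmMember g hgr hgnz hgσ hE hd hψ hn hδ
  exact ⟨A, φ, e, g e.n, hW.dim_eq, hW.isSmoothProjective, hW.sq_eq, hgr _, hgnz _ hen, hN, hW, hcm,
    EllipticCurve.hodgeConjectureFor_of_hodgeOneZero_mem_span_pullback hE ψ₀ hd hψ A hgen,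
    fun p y hy hpp => EllipticCurve.hodgeClasses_divisorial_of_hodgeOneZero_mem_span_pullback hE ψ₀ hd hψ A hgen p y hy hpp⟩

/-- **On the CM anchor the conclusion of `WeilClassesComponent n d δ` is TRUE**: every right-sign cell contains a
member meeting all premises of the cell's target on which every rational `(n,n)` class (in particular every Weil
class) IS algebraic — the target of an open cell is decided affirmatively at one of its points. UNCONDITIONAL.
[cite: vanGeemen1994HodgeAV, Thm. 4.3, 4.14 and 5.3] -/
theorem weilClassesComponent_holds_at_cmAnchor {n d : ℕ} (hn : 0 < n) (hd : 0 < d) {δ : weilNormResidueGroup d}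
    (hδ : weilSign d δ = (-1) ^ n) :
    ∃ (A : AbelianVariety ℂ) (φ : A ⟶ A) (e : ProjectiveEmbedding A.X) (a : complexBetti (projectiveSpace e.n ℂ) 2),
      A.dim = 2 * n ∧ IsSmoothProjective (2 * n) A.X ∧ φ ≫ φ = -(d • 𝟙 A) ∧ IsRationalClass a ∧ a ≠ 0 ∧
        HasWeilDiscriminantNondeg A φ n d
          ((d : ℂ) • complexBetti.map e.ι 2 a + complexBetti.map φ.hom.hom.hom 2 (complexBetti.map e.ι 2 a)) δ ∧
        (∃ c ∈ weilClassesOf A φ n d, IsRationalClass c ∧ IsOfHodgeType (2 * n) A.X (2 * n) n n c ∧ c ≠ 0) ∧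
        ∀ c : complexBetti A.X (2 * n), IsRationalClass c → IsOfHodgeType (2 * n) A.X (2 * n) n n c →
          c ∈ algebraicClasses A.X n := by
  obtain ⟨A, φ, e, a, hA, hX, hφ, ha, ha0, hN, hW, -, hHC, -⟩ := weilComponent_cmAnchor hn hd hδ
  refine ⟨A, φ, e, a, hA, hX, hφ, ha, ha0, hN, exists_weilClass_of_isWeilType hW, fun c hc hcH => hHC.2 n c hc ?_⟩
  rw [hA]; exact hcH

/-- Gen 5's anchor predicate `divisorGeneratedCMAnchor` (census VII-C: "met in print on every component by the
diagonal member") is met in the kernel, in every right-sign cell, by a MEMBER OF THAT CELL. [cite: vanGeemen1994HodgeAV, 5.3–5.5] -/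
theorem divisorGeneratedCMAnchor_of_cmAnchor {n d : ℕ} (hn : 0 < n) (hd : 0 < d) {δ : weilNormResidueGroup d}
    (hδ : weilSign d δ = (-1) ^ n) :
    ∃ (A : AbelianVariety ℂ) (φ : A ⟶ A) (e : ProjectiveEmbedding A.X) (a : complexBetti (projectiveSpace e.n ℂ) 2),
      A.dim = 2 * n ∧ IsSmoothProjective (2 * n) A.X ∧ φ ≫ φ = -(d • 𝟙 A) ∧ IsRationalClass a ∧ a ≠ 0 ∧
        HasWeilDiscriminantNondeg A φ n d
          ((d : ℂ) • complexBetti.map e.ι 2 a + complexBetti.map φ.hom.hom.hom 2 (complexBetti.map e.ι 2 a)) δ ∧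
        ∀ x : complexBetti A.X (2 * n), divisorGeneratedCMAnchor n A.X x := by
  obtain ⟨A, φ, e, a, hA, hX, hφ, ha, ha0, hN, -, hcm, -, hdiv⟩ := weilComponent_cmAnchor hn hd hδ
  exact ⟨A, φ, e, a, hA, hX, hφ, ha, ha0, hN, fun _ => ⟨A, ⟨Iso.refl _⟩, hA, hcm, fun y hy hyH => hdiv n y hy hyH⟩⟩

/-! ### §2 The exact residual of a cell: isogeny-connectedness of the component + the variational instance -/

/-- **`IsogenyConnectedWeilComponent n d δ` — the component `(ℚ(√-d), 2n, δ)` of Weil's moduli space is connected up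
to isogeny and carries the Weil section (typed missing input; a MODULI statement, NOT a case of HC; NOT a
Literature fact).** For any two polarized members `(A, φ, h_K)`, `(A₀, φ₀, h_{K,0})` of the component (both of exact
discriminant class `δ`) and any non-zero rational `(n,n)` Weil class `c` on `A`: a smooth projective
`(ℚ(√-d), 2n, δ)`-Weil family `f : 𝒳 ⟶ S` (`𝒳`, `S` quasi-projective, `S` smooth irreducible) with a global class `W`
fibrewise rational of type `(n,n)`, a fibre `𝒳_{s₁} ≅ A.X` on which `W` reads `c`, and a fibre `𝒳_{s₀} ≅ A₀'.X` with
`A₀'` ISOGENOUS to `A₀`. In print: "the triple `(n, K, det H)` … is a discrete invariant of a component of the moduli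
space, which determines it up to isogenies of abelian varieties of Weil type" (Markman p. 3, after van Geemen:
Landherr — signature `(n,n)` and `det H` classify the `K`-Hermitian space —, the connected period domain of `SU(n,n)`,
the universal family over a level cover, and the flat Weil section lifted by the global invariant cycle theorem).
OPEN formally (no moduli of Weil type in `Literature/`). [cite: Markman2025SecantWeil, p. 3 (preprint, unrefereed)]
[cite: vanGeemen1994HodgeAV, Lemma 5.2 (3) and 5.3–5.5] [cite: Deligne1982HodgeCycles, §4, proof of Thm. 4.8 (a)–(c) and §5]
[status: open] -/
@[conjecture] def IsogenyConnectedWeilComponent (n d : ℕ) (δ : weilNormResidueGroup d) : Prop :=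
  ∀ (A : AbelianVariety ℂ) (φ : A ⟶ A), A.dim = 2 * n → IsSmoothProjective (2 * n) A.X → φ ≫ φ = -(d • 𝟙 A) →
    ∀ (e : ProjectiveEmbedding A.X) (a : complexBetti (projectiveSpace e.n ℂ) 2), IsRationalClass a → a ≠ 0 →
      HasWeilDiscriminantNondeg A φ n d
        ((d : ℂ) • complexBetti.map e.ι 2 a + complexBetti.map φ.hom.hom.hom 2 (complexBetti.map e.ι 2 a)) δ →
      ∀ c : complexBetti A.X (2 * n), IsRationalClass c → IsOfHodgeType (2 * n) A.X (2 * n) n n c →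
        c ∈ weilClassesOf A φ n d → c ≠ 0 →
      ∀ (A₀ : AbelianVariety ℂ) (φ₀ : A₀ ⟶ A₀), A₀.dim = 2 * n → IsSmoothProjective (2 * n) A₀.X →
        φ₀ ≫ φ₀ = -(d • 𝟙 A₀) →
        ∀ (e₀ : ProjectiveEmbedding A₀.X) (a₀ : complexBetti (projectiveSpace e₀.n ℂ) 2), IsRationalClass a₀ → a₀ ≠ 0 →
          HasWeilDiscriminantNondeg A₀ φ₀ n d
            ((d : ℂ) • complexBetti.map e₀.ι 2 a₀ + complexBetti.map φ₀.hom.hom.hom 2 (complexBetti.map e₀.ι 2 a₀)) δ →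
          ∃ (𝒳 S : SchemeOver ℂ) (f : 𝒳 ⟶ S) (s₁ s₀ : ComplexPoints S) (ι : A.X ≅ fiberOver f s₁)
              (A₀' : AbelianVariety ℂ) (W : complexBetti 𝒳 (2 * n)),
            A₀'.IsIsogenous A₀ ∧ A₀'.dim = 2 * n ∧ Nonempty (A₀'.X ≅ fiberOver f s₀) ∧
            IsSmoothProjectiveFamily f (2 * n) ∧ IsQuasiProjectiveOver 𝒳 ∧ IsQuasiProjectiveOver S ∧
            IrreducibleSpace S.left ∧ AlgebraicGeometry.Smooth S.hom ∧
            (∀ s : ComplexPoints S,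
              IsRationalClass (complexBetti.map (fiberι f s) (2 * n) W) ∧
                IsOfHodgeType (2 * n) (fiberOver f s) (2 * n) n n (complexBetti.map (fiberι f s) (2 * n) W)) ∧
            HasWeilChartsOfDisc n d δ f W ∧
            complexBetti.map ι.hom (2 * n) (complexBetti.map (fiberι f s₁) (2 * n) W) = c

/-- **R∞anc(δ) from isogeny-connectedness** (right sign): join the given member to the CM ANCHOR of the cell
(`weilComponent_cmAnchor`); at the anchor end the fibre is charted by `A₀'` isogenous to the anchor, where the
Hodge conjecture holds (Tate, and Lemma 3.7 isogeny invariance `HodgeConjectureFor.of_isIsogenous`), so the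
restricted class is algebraic there. [cite: vanGeemen1994HodgeAV, Lemma 3.7, Thm. 4.3 and 5.3–5.5] -/
theorem anchoredWeilFamiliesComponent_of_isogenyConnected {n d : ℕ} (hn : 0 < n) (hd : 0 < d)
    {δ : weilNormResidueGroup d} (hδ : weilSign d δ = (-1) ^ n) (hI : IsogenyConnectedWeilComponent n d δ) :
    AnchoredWeilFamiliesComponent n d δ := by
  intro A φ hAdim hX hφ e a haQ ha0 hN c hcQ hcH hc hc0
  obtain ⟨A₀, φ₀, e₀, a₀, hA₀, hX₀, hφ₀, ha₀, ha₀0, hN₀, -, -, hHC, -⟩ := weilComponent_cmAnchor hn hd hδ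
  obtain ⟨𝒳, S, f, s₁, s₀, ι, A₀', W, hiso, hA₀'dim, ⟨ι₀⟩, hf, h𝒳, hS, hirr, hsm, hW, hch, hread⟩ :=
    hI A φ hAdim hX hφ e a haQ ha0 hN c hcQ hcH hc hc0 A₀ φ₀ hA₀ hX₀ hφ₀ e₀ a₀ ha₀ ha₀0 hN₀
  refine ⟨𝒳, S, f, s₁, s₀, ι, W, hf, h𝒳, hS, hirr, hsm, hW, hch, hread, ?_⟩
  have hHC' : HodgeConjectureFor A₀'.dim A₀'.X := HodgeConjectureFor.of_isIsogenous hiso hHC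
  have hx' : complexBetti.map ι₀.hom (2 * n) (complexBetti.map (fiberι f s₀) (2 * n) W) ∈ algebraicClasses A₀'.X n := by
    refine hHC'.2 n _ ((isRationalClass_map_iff_of_iso ι₀).2 (hW s₀).1) ?_
    rw [hA₀'dim]
    exact (isOfHodgeType_map_iff_of_iso ι₀).2 (hW s₀).2
  exact (mem_algebraicClasses_map_iff_of_iso ι₀).1 hx'

/-- **EVERY CELL from isogeny-connectedness and the variational instance** (`n ≥ 1`, `d ≥ 1`, every `δ`): a
wrong-sign cell is empty (gen 7, `weilClassesComponent_of_weilSign_ne`); a right-sign cell has its CM anchor, so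
isogeny-connectedness gives R∞anc(δ) and gen 5's anchor engine `weilClassesComponent_of_anchored_of_variational`
concludes. The per-cell residual of the Weil column is thus a MODULI statement plus ONE VHC instance; the anchor
input is discharged. [cite: vanGeemen1994HodgeAV, 4.14, 5.3–5.5] [cite: CharlesSchnell2014Notes, Conj. 11.3.1]
[cite: Markman2025SecantWeil, Thm. 1.5.1 (strategy; preprint, unrefereed)] -/
theorem weilClassesComponent_of_isogenyConnected_of_variational {n d : ℕ} (hn : 0 < n) (hd : 0 < d)
    {δ : weilNormResidueGroup d} (hI : IsogenyConnectedWeilComponent n d δ)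
    (hV : WeilVariationalHodgeComponent n d δ) : WeilClassesComponent n d δ := by
  by_cases h : weilSign d δ = (-1) ^ n
  · exact weilClassesComponent_of_anchored_of_variational
      (anchoredWeilFamiliesComponent_of_isogenyConnected hn hd h hI) hV
  · exact weilClassesComponent_of_weilSign_ne hn hd h

/-- **The column**: `WeilClassesByComponent` from isogeny-connectedness and the variational instance on the
RIGHT-SIGN components only. [cite: vanGeemen1994HodgeAV, 4.14 and 5.3–5.5] [cite: CharlesSchnell2014Notes, Conj. 11.3.1] -/
theorem weilClassesByComponent_of_isogenyConnected_of_variational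
    (h : ∀ n : ℕ, 2 ≤ n → ∀ d : ℕ, 0 < d → ∀ δ : weilNormResidueGroup d, weilSign d δ = (-1) ^ n →
      IsogenyConnectedWeilComponent n d δ ∧ WeilVariationalHodgeComponent n d δ) :
    WeilClassesByComponent := by
  intro n hn d hd δ
  by_cases hs : weilSign d δ = (-1) ^ n
  · exact weilClassesComponent_of_isogenyConnected_of_variational (by omega) hd (h n hn d hd δ hs).1 (h n hn d hd δ hs).2
  · exact weilClassesComponent_of_weilSign_ne (by omega) hd hs

/-- **The dim `≤ 5` floor with the per-cell residual `IsogenyConnected ∧ VHC`** on the positive non-split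
squarefree fourfold cells `(2, d₀, δ)`, `d₀ ∉ {1, 3}` (gen 7's floor `…_of_refereed_and_positive_residualSq` with
each residual cell discharged to its moduli statement and its variational instance; the refereed facts, Landherr's
criterion and Markman 2023 as there). [cite: MoonenZarhin1999, Thm. 0.1] [cite: Markman2023GeneralizedKummers, Thm 1.5]
[cite: vanGeemen1994HodgeAV, 5.3–5.5] [cite: CharlesSchnell2014Notes, Conj. 11.3.1] -/
theorem hodgeConjectureFor_abelian_dim_le_five_of_refereed_connected_variational
    (hred : MoonenZarhin1999_hodgeClasses_abelian_dim_le_five_of_weilClassesFourfolds)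
    (hK : Koike2004_weilClasses_algebraic_hyperbolicSixfold_one)
    (hS : Schoen1998_weilClasses_algebraic_hyperbolicSixfold_three)
    (hL : LandherrSplitCriterion) (hM23 : Markman2023_weilClasses_algebraic_discOneWeilFourfold)
    (hCV : ∀ d : ℕ, 0 < d → Squarefree d → d ≠ 1 → d ≠ 3 → ∀ δ : weilNormResidueGroup d,
      δ ≠ splitDiscriminantClass 2 d → weilSign d δ = 1 →
        IsogenyConnectedWeilComponent 2 d δ ∧ WeilVariationalHodgeComponent 2 d δ)
    (A : AbelianVariety ℂ) (hA : A.dim ≤ 5) : HodgeConjectureFor A.dim A.X :=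
  hodgeConjectureFor_abelian_dim_le_five_of_refereed_and_positive_residualSq hred hK hS hL hM23
    (fun d hd hsq h1 h3 δ hns hδ =>
      weilClassesComponent_of_isogenyConnected_of_variational two_pos hd (hCV d hd hsq h1 h3 δ hns hδ).1
        (hCV d hd hsq h1 h3 δ hns hδ).2) A hA

end Summit.HodgeConjecture.HodgeConjecture.Ring2.AbelianAll

end
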